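import Mathlib
import Summits.ResolutionOfSingularities.ResolutionOfSingularities.Theorems.HomologicalConductorPersistenceDualNumberAddCover
import HarnessLib

/-!
# Rung S-2 `PersistenceSurface` (stmt-ResolutionOfSingularities-19970) — W4.4b U5, part 2/2:
# `HasStepDualCover` IS INHABITED at a MAXIMAL-CONDUCTOR step (`𝔪_{T′} ⊆ ca⁴(T′)`), via the dual numbers
# over the residue field

Route `ResolutionOfSingularities/HomologicalConductor`, chain W4.4b (cell res-hironaka; seat res-D-pv-043, o10-lineage
hand; object «U5» of res-L1-w44b-plan-1's CHAIN v11.1 §V11.11 (b), offered 2026-08-27T09:15:07Z, re-routed «to the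
next o-lineage hand» by res-D-pv-026 09:16:00Z). OURS; nothing here is a statement of the manuscript under review
(Hironaka 2017); AI-written, weaker than expert review.

CONTEXT. res-L1-w44b-tri-1's (DC) custody memo (DC-CUSTODY.md 5a787a7006c0211d) found that along the normalised
`ca`-tower of a rational surface singularity some steps `T → T′` land in an upper point with MAXIMAL CONDUCTOR,
`ca⁴(𝒪̂_{T′}) = 𝔪̂_{T′}`; there level-four persistence is trivial (`ca⁴(T)·T′ ⊆ 𝔪_{T′} ⊆ ca⁴(T′)`), but the typed premise
of the door, o6b's `RationalNormalStepDualCover` (p509308), asks for an inhabitant of o8's `HasStepDualCover T T′`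
(p507867) at EVERY step. This file supplies it at such steps WITHOUT geometry (tri-1's junk regime J4), so the typed
premise stays true as typed and res-type-011's disjunction glue o12 is a belt to these braces.

THE MODEL (a variant of plan-1's `T″ := T′ ⧸ 𝔪′²`: we use the DUAL NUMBERS `D := k′[ε]` over the residue field
`k′ = T′ ⧸ 𝔪′`, where Mathlib already knows the ideal theory). Data of `HasStepDualCover T T′`:
`T₁ := T″ := D` (noetherian: a principal ideal ring), the `T`- and `T′`-algebra structures through `T → T′ → k′ → D`;
* ASCENT `ca⁴(T)·D ⊆ ca⁴(D)`: `ca⁴(T) ≠ ⊤` (the lower stage is singular) lies in `𝔪_T`, which the LOCAL map `T → T′`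
  sends into `𝔪_{T′}`, which dies in `k′` — so the extended ideal is `⊥`;
* DESCENT `ca⁴(D) ∩ T′ ⊆ ca⁴(T′)`: `D` is local noetherian and NOT regular (`ε ≠ 0 = ε²`), so `ca⁴(D) ≠ ⊤`
  (`isRegularLocalRing_of_cohomologyAnnihilatorOfDegree_eq_top`), hence `ca⁴(D) ⊆ (ε)` by Mathlib's
  `DualNumber.ideal_trichotomy`, and `(ε) ∩ T′ = 𝔪_{T′} ⊆ ca⁴(T′)` by the maximal-conductor hypothesis;
* COVER: `Y := (ε) ⊂ D` (≅ `k′`) is a third syzygy of itself (`0 → (ε) → D → (ε) → 0`, iterated); the block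
  `((D ⊗_D Y))* ≅ Hom_D((ε), D) ≅ (ε)` has `Y` as a retract; and EVERY finitely generated `D`-module lies in
  `add (D ⊕ Y)` (a functional splits off a copy of `D` as long as `ε` acts non-trivially, and a copy of `Y` from what
  is left; induction on the `k′`-dimension) — so o10a's `hasStepDualCover_of_addCover` applies with `G := D ⊕ Y`.

Part 1/2 = `…PersistenceDualNumberAddCover` (the `k[ε]` facts: `caⁿ(k[ε]) ⊆ (ε)`, `(ε)` a third syzygy of itself,
`(ε)` a retract of the dual block). Main results here:
* `isRetractOfPower_dualNumber` — every finitely generated `k[ε]`-module lies in `add (k[ε] ⊕ (ε))`;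
* `hasStepDualCover_of_maximalIdeal_le_cohomologyAnnihilatorOfDegree_four` — `T`, `T′` noetherian local,
  `T → T′` local, `ca⁴(T) ≠ ⊤`, `𝔪_{T′} ⊆ ca⁴(T′)` ⊢ `HasStepDualCover T T′`.

References: S. B. Iyengar, R. Takahashi, *Annihilation of cohomology and strong generation of module categories*,
IMRN 2016 [`IyengarTakahashi2014`]; OURS planning texts (index only): L/w44b/CHAIN.md v11.1 §V11.11 (b),
L/res-L1-w44b-tri-1/dc/DC-CUSTODY.md §3.2.
-/

set_option linter.dupNamespace false

noncomputable section

open CategoryTheory Literature.RingTheory.CohomologyAnnihilator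
open TrivSqZeroExt DualNumber
open Summit.ResolutionOfSingularities.ResolutionOfSingularities.Theorems.NoZeno.SandwichCluster
open Summit.ResolutionOfSingularities.ResolutionOfSingularities.Theorems.HomologicalConductor.PersistenceSurfaceRationalAssembly
open Summit.ResolutionOfSingularities.ResolutionOfSingularities.Theorems.HomologicalConductor.PersistenceSurfaceStepAddCover
open Summit.ResolutionOfSingularities.ResolutionOfSingularities.Theorems.HomologicalConductor.PersistenceDualNumberAddCover
open scoped TensorProduct DualNumber

namespace Summit.ResolutionOfSingularities.ResolutionOfSingularities.Theorems.HomologicalConductor.PersistenceSurfaceMaximalConductorStep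

universe u

section DualNumbers

variable (k : Type u) [Field k]

/-! ## §4 Every finitely generated `k[ε]`-module lies in `add (k[ε] ⊕ (ε))` -/

/-- A retract pair `φ ∘ s = id` splits: `L ≃ M × ker φ`. [folklore] -/
theorem nonempty_linearEquiv_prod_ker {R : Type*} [Ring R] {L M : Type*} [AddCommGroup L] [Module R L]
    [AddCommGroup M] [Module R M] (φ : L →ₗ[R] M) (s : M →ₗ[R] L) (h : φ ∘ₗ s = LinearMap.id) :
    Nonempty (L ≃ₗ[R] (M × LinearMap.ker φ)) := by
  have hs : ∀ m, φ (s m) = m := fun m => LinearMap.congr_fun h m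
  refine ⟨{ toFun := fun z => (φ z, ⟨z - s (φ z), by rw [LinearMap.mem_ker, map_sub, hs, sub_self]⟩)
            invFun := fun p => s p.1 + (p.2 : L)
            map_add' := fun z z' => by
              ext
              · simp only [map_add, Prod.mk_add_mk]
              · simp only [map_add, Prod.mk_add_mk, Submodule.coe_add]
                abel
            map_smul' := fun c z => by
              ext
              · simp only [map_smul, Prod.smul_mk, RingHom.id_apply]
              · simp only [map_smul, Prod.smul_mk, RingHom.id_apply, Submodule.coe_smul, smul_sub]
            left_inv := fun z => by simp
            right_inv := fun p => by
              obtain ⟨m, w, hw⟩ := p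
              have hw' : φ w = 0 := hw
              ext <;> simp [hs, hw'] }⟩

/-- In a `k[ε]`-module with compatible `k`-structure: `d • z = fst d • z + snd d • (ε • z)`. [folklore] -/
theorem smul_eq_fst_smul_add {L : Type*} [AddCommGroup L] [Module k[ε] L] [Module k L]
    [IsScalarTower k k[ε] L] (d : k[ε]) (z : L) :
    d • z = fst d • z + snd d • ((ε : k[ε]) • z) := by
  conv_lhs => rw [← inl_fst_add_inr_snd_eq d]
  rw [add_smul, inr_eq_smul_eps, smul_assoc]
  congr 1
  rw [← algebraMap_smul (A := k[ε]) (fst d) z]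
  rfl

/-- **Structure of finitely generated `k[ε]`-modules, in `add` form.** Every finitely generated `k[ε]`-module `L`
(with its `k`-structure by restriction) lies in `add (k[ε] ⊕ (ε))`: if `ε` acts non-trivially, a `k[ε]`-linear
functional with `φ x = 1` splits off a free summand `k[ε] • x`; if `ε` acts trivially, a functional splits off a copy
of `(ε) ≅ k`; induction on `dim_k L`. [folklore] -/
theorem isRetractOfPower_dualNumber_aux (n : ℕ) :
    ∀ (L : Type u) [AddCommGroup L] [Module k[ε] L] [Module k L] [IsScalarTower k k[ε] L]
      [Module.Finite k L], Module.finrank k L ≤ n →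
      IsRetractOfPower (ModuleCat.of k[ε] (k[ε] × ↥(Ideal.span {(ε : k[ε])}))) (ModuleCat.of k[ε] L) := by
  haveI hfinD : Module.Finite k k[ε] := by
    change Module.Finite k (k × k)
    infer_instance
  induction n with
  | zero =>
    intro L _ _ _ _ _ hL
    have h0 : Module.finrank k L = 0 := Nat.le_zero.mp hL
    haveI : Subsingleton L := Module.finrank_zero_iff.mp h0
    exact isRetractOfPower_of_isZero _ (ModuleCat.isZero_of_subsingleton _)
  | succ n ih =>
    intro L _ _ _ _ _ hL
    set Y : Submodule k[ε] k[ε] := Ideal.span {(ε : k[ε])} with hYdef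
    have hεY : (ε : k[ε]) ∈ Y := Ideal.subset_span rfl
    by_cases hsub : Subsingleton L
    · exact isRetractOfPower_of_isZero _ (ModuleCat.isZero_of_subsingleton _)
    rw [not_subsingleton_iff_nontrivial] at hsub
    by_cases hε : ∀ z : L, (ε : k[ε]) • z = 0
    · -- CASE B: `ε` acts trivially; split off a copy of `Y ≅ k`
      obtain ⟨x, hx⟩ := exists_ne (0 : L)
      obtain ⟨f, hfx, -⟩ := Submodule.exists_dual_map_eq_bot_of_notMem (p := (⊥ : Submodule k L)) (x := x)
        (by rwa [Submodule.mem_bot]) inferInstance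
      let lam : Module.Dual k L := (f x)⁻¹ • f
      have hlam : lam x = 1 := by simp [lam, inv_mul_cancel₀ hfx]
      -- `r : L → Y`, `z ↦ lam z • ε`
      let r : L →ₗ[k[ε]] ↥Y :=
        { toFun := fun z => ⟨inr (lam z), by rw [inr_eq_smul_eps]; exact Y.smul_of_tower_mem _ hεY⟩
          map_add' := fun z z' => Subtype.ext (by
            change inr (lam (z + z')) = inr (lam z) + inr (lam z')
            rw [map_add, inr_add])
          map_smul' := fun d z => Subtype.ext (by
            change inr (lam (d • z)) = d * inr (lam z)
            have e1 : lam (d • z) = fst d * lam z := by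
              rw [smul_eq_fst_smul_add k d z, hε z, smul_zero, add_zero, lam.map_smul, smul_eq_mul]
            rw [e1]
            exact TrivSqZeroExt.ext (by simp) (by simp [mul_comm])) }
      -- `i : Y → L`, `y ↦ snd y • x`
      let i : ↥Y →ₗ[k[ε]] L :=
        { toFun := fun y => snd (y : k[ε]) • x
          map_add' := fun y y' => by simp [add_smul]
          map_smul' := fun d y => by
            have hy : fst (y : k[ε]) = 0 := (mem_span_eps_iff k _).mp y.2
            change snd (d * (y : k[ε])) • x = d • (snd (y : k[ε]) • x)
            rw [smul_eq_fst_smul_add k d, hε, smul_zero, add_zero, DualNumber.snd_mul, hy, mul_zero, add_zero,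
              mul_smul] }
      have hri : r ∘ₗ i = LinearMap.id := by
        refine LinearMap.ext fun y => Subtype.ext ?_
        have hy : fst (y : k[ε]) = 0 := (mem_span_eps_iff k _).mp y.2
        change inr (lam (snd (y : k[ε]) • x)) = (y : k[ε])
        rw [map_smul, hlam, smul_eq_mul, mul_one]
        conv_rhs => rw [← inl_fst_add_inr_snd_eq (y : k[ε]), hy, inl_zero, zero_add]
      obtain ⟨e⟩ := nonempty_linearEquiv_prod_ker r i hri
      -- dimension count: `dim ker r < dim L`
      haveI : Module.Finite k ↥Y := Module.Finite.of_injective (Y.subtype.restrictScalars k) Subtype.val_injective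
      have hYpos : 0 < Module.finrank k ↥Y := by
        rw [Module.finrank_pos_iff_exists_ne_zero]
        exact ⟨⟨ε, hεY⟩, fun h => by
          have := congrArg (fun y : ↥Y => snd (y : k[ε])) h
          simp [snd_eps] at this⟩
      haveI : Module.Finite k ↥(LinearMap.ker r) :=
        Module.Finite.of_injective ((LinearMap.ker r).subtype.restrictScalars k) Subtype.val_injective
      have hdim : Module.finrank k L = Module.finrank k ↥Y + Module.finrank k ↥(LinearMap.ker r) := by
        rw [(e.restrictScalars k).finrank_eq, Module.finrank_prod]
      have hker : Module.finrank k ↥(LinearMap.ker r) ≤ n := by omega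
      have hK := ih ↥(LinearMap.ker r) hker
      have hYadd : IsRetractOfPower (ModuleCat.of k[ε] (k[ε] × ↥Y)) (ModuleCat.of k[ε] ↥Y) :=
        isRetractOfPower_snd (ModuleCat.of k[ε] k[ε]) (ModuleCat.of k[ε] ↥Y)
      exact (hYadd.prod hK).of_iso e.symm.toModuleIso
    · -- CASE A: some `ε • x ≠ 0`; split off a free summand `k[ε] • x`
      obtain ⟨x, hx⟩ := not_forall.mp hε
      have hnot : (ε : k[ε]) • x ∉ (k ∙ x : Submodule k L) := by
        intro hmem
        obtain ⟨a, ha⟩ := Submodule.mem_span_singleton.mp hmem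
        have h2 : (ε : k[ε]) • ((ε : k[ε]) • x) = 0 := by
          rw [← mul_smul, DualNumber.eps_mul_eps, zero_smul]
        rw [← ha, smul_comm] at h2
        rcases smul_eq_zero.mp h2 with h3 | h3
        · rw [h3, zero_smul] at ha; exact hx ha.symm
        · exact hx h3
      obtain ⟨f, hfx, hf0⟩ := Submodule.exists_dual_map_eq_bot_of_notMem hnot inferInstance
      have hfx0 : f x = 0 := by
        have : f x ∈ (k ∙ x : Submodule k L).map f := Submodule.mem_map_of_mem (Submodule.mem_span_singleton_self x)
        rw [hf0, Submodule.mem_bot] at this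
        exact this
      let lam : Module.Dual k L := (f ((ε : k[ε]) • x))⁻¹ • f
      have hlam1 : lam ((ε : k[ε]) • x) = 1 := by simp [lam, inv_mul_cancel₀ hfx]
      have hlam0 : lam x = 0 := by simp [lam, hfx0]
      -- `φ : L → k[ε]`, `z ↦ (lam (ε • z), lam z)`
      let φ : L →ₗ[k[ε]] k[ε] :=
        { toFun := fun z => inl (lam ((ε : k[ε]) • z)) + inr (lam z)
          map_add' := fun z z' => by
            simp only [smul_add, map_add, inl_add, inr_add]; abel
          map_smul' := fun d z => by
            have h1 : (ε : k[ε]) • (d • z) = fst d • ((ε : k[ε]) • z) := by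
              rw [← mul_smul, show (ε : k[ε]) * d = d * ε from mul_comm _ _, mul_smul,
                smul_eq_fst_smul_add k d ((ε : k[ε]) • z), ← mul_smul, DualNumber.eps_mul_eps, zero_smul,
                smul_zero, add_zero]
            have e1 : lam ((ε : k[ε]) • (d • z)) = fst d * lam ((ε : k[ε]) • z) := by
              rw [h1, lam.map_smul, smul_eq_mul]
            have e2 : lam (d • z) = fst d * lam z + snd d * lam ((ε : k[ε]) • z) := by
              rw [smul_eq_fst_smul_add k d z, map_add, lam.map_smul, lam.map_smul, smul_eq_mul, smul_eq_mul]
            change inl (lam ((ε : k[ε]) • (d • z))) + inr (lam (d • z)) =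
              d * (inl (lam ((ε : k[ε]) • z)) + inr (lam z))
            rw [e1, e2]
            exact TrivSqZeroExt.ext (by simp) (by simp) }
      have hφx : φ x = 1 := by
        change inl (lam ((ε : k[ε]) • x)) + inr (lam x) = 1
        rw [hlam1, hlam0, inr_zero, add_zero]; rfl
      let s : k[ε] →ₗ[k[ε]] L := LinearMap.toSpanSingleton k[ε] L x
      have hφs : φ ∘ₗ s = LinearMap.id := by
        refine LinearMap.ext fun d => ?_
        rw [LinearMap.comp_apply, LinearMap.toSpanSingleton_apply, map_smul, hφx, smul_eq_mul, mul_one,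
          LinearMap.id_apply]
      obtain ⟨e⟩ := nonempty_linearEquiv_prod_ker φ s hφs
      have hDpos : 0 < Module.finrank k k[ε] := Module.finrank_pos
      haveI : Module.Finite k ↥(LinearMap.ker φ) :=
        Module.Finite.of_injective ((LinearMap.ker φ).subtype.restrictScalars k) Subtype.val_injective
      have hdim : Module.finrank k L = Module.finrank k k[ε] + Module.finrank k ↥(LinearMap.ker φ) := by
        rw [(e.restrictScalars k).finrank_eq, Module.finrank_prod]
      have hker : Module.finrank k ↥(LinearMap.ker φ) ≤ n := by omega
      have hK := ih ↥(LinearMap.ker φ) hker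
      have hDadd : IsRetractOfPower (ModuleCat.of k[ε] (k[ε] × ↥Y)) (ModuleCat.of k[ε] k[ε]) :=
        isRetractOfPower_fst (ModuleCat.of k[ε] k[ε]) (ModuleCat.of k[ε] ↥Y)
      exact (hDadd.prod hK).of_iso e.symm.toModuleIso

/-- **Every finitely generated `k[ε]`-module lies in `add (k[ε] ⊕ (ε))`.** [folklore] -/
theorem isRetractOfPower_dualNumber (L : Type u) [AddCommGroup L] [Module k[ε] L] [Module.Finite k[ε] L] :
    IsRetractOfPower (ModuleCat.of k[ε] (k[ε] × ↥(Ideal.span {(ε : k[ε])}))) (ModuleCat.of k[ε] L) := by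
  letI : Module k L := Module.compHom L (algebraMap k k[ε])
  haveI : IsScalarTower k k[ε] L := IsScalarTower.of_algebraMap_smul fun _ _ => rfl
  haveI : Module.Finite k k[ε] := by
    change Module.Finite k (k × k)
    infer_instance
  haveI : Module.Finite k L := Module.Finite.trans k[ε] L
  exact isRetractOfPower_dualNumber_aux k (Module.finrank k L) L le_rfl

end DualNumbers

/-! ## §5 The maximal-conductor step -/

/-- **U5 · `HasStepDualCover` at a MAXIMAL-CONDUCTOR step (OURS).** `T`, `T′` noetherian local rings, `T → T′` a
local homomorphism, `ca⁴(T) ≠ T` (the lower stage is singular) and `𝔪_{T′} ⊆ ca⁴(T′)` (the upper stage has maximal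
level-four conductor). Then o8's `HasStepDualCover T T′` is inhabited by `T₁ := T″ := k′[ε]` (`k′ = T′⧸𝔪′`),
`Y := (ε)` and the cover of §4 — no geometry. Consequently o6b's `RationalNormalStepDualCover` is not refuted by such
steps (res-L1-w44b-tri-1's (DC) custody memo), and the door's typed premise keeps its meaning.
[cite: IyengarTakahashi2014, Definition 4.1] -/
theorem hasStepDualCover_of_maximalIdeal_le_cohomologyAnnihilatorOfDegree_four
    {T T' : Type} [CommRing T] [CommRing T'] [Algebra T T'] [IsNoetherianRing T] [IsNoetherianRing T']
    [IsLocalRing T] [IsLocalRing T'] [IsLocalHom (algebraMap T T')]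
    (hT : cohomologyAnnihilatorOfDegree T 4 ≠ ⊤)
    (hT' : IsLocalRing.maximalIdeal T' ≤ cohomologyAnnihilatorOfDegree T' 4) :
    HasStepDualCover T T' := by
  -- the dual numbers `D` over the residue field `K` of `T′`, as a `T′`- and a `T`-algebra through `T → T′ → K → D`
  letI : Algebra T' ((IsLocalRing.ResidueField T')[ε]) :=
    ((algebraMap (IsLocalRing.ResidueField T') ((IsLocalRing.ResidueField T')[ε])).comp
      (IsLocalRing.residue T')).toAlgebra
  letI : Algebra T ((IsLocalRing.ResidueField T')[ε]) :=
    ((algebraMap T' ((IsLocalRing.ResidueField T')[ε])).comp (algebraMap T T')).toAlgebra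
  have hsq : ∀ t : T, algebraMap ((IsLocalRing.ResidueField T')[ε]) ((IsLocalRing.ResidueField T')[ε])
      (algebraMap T ((IsLocalRing.ResidueField T')[ε]) t) =
      algebraMap T' ((IsLocalRing.ResidueField T')[ε]) (algebraMap T T' t) := fun t => rfl
  -- ascent: `ca⁴(T)` maps to `⊥`
  have hasc : (cohomologyAnnihilatorOfDegree T 4).map (algebraMap T ((IsLocalRing.ResidueField T')[ε])) ≤
      cohomologyAnnihilatorOfDegree ((IsLocalRing.ResidueField T')[ε]) 4 := by
    rw [Ideal.map_le_iff_le_comap]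
    intro x hx
    have hxm : x ∈ IsLocalRing.maximalIdeal T := IsLocalRing.le_maximalIdeal hT hx
    have hxm' : ¬ IsUnit x := (IsLocalRing.mem_maximalIdeal _).mp hxm
    have hx' : algebraMap T T' x ∈ IsLocalRing.maximalIdeal T' :=
      (IsLocalRing.mem_maximalIdeal _).mpr fun hu => hxm' ((isUnit_map_iff (algebraMap T T') x).mp hu)
    rw [Ideal.mem_comap]
    have h0 : algebraMap T ((IsLocalRing.ResidueField T')[ε]) x = 0 := by
      change algebraMap (IsLocalRing.ResidueField T') ((IsLocalRing.ResidueField T')[ε])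
        (IsLocalRing.residue T' (algebraMap T T' x)) = 0
      rw [(IsLocalRing.residue_eq_zero_iff _).mpr hx', map_zero]
    rw [h0]
    exact Submodule.zero_mem _
  -- descent: `ca⁴(K[ε]) ⊆ (ε)`, whose preimage in `T′` is `𝔪′ ⊆ ca⁴(T′)`
  have hdesc : (cohomologyAnnihilatorOfDegree ((IsLocalRing.ResidueField T')[ε]) 4).comap
      (algebraMap T' ((IsLocalRing.ResidueField T')[ε])) ≤ cohomologyAnnihilatorOfDegree T' 4 := by
    intro x hx
    rw [Ideal.mem_comap] at hx
    have h1 : fst (algebraMap T' ((IsLocalRing.ResidueField T')[ε]) x) = 0 :=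
      (mem_span_eps_iff (IsLocalRing.ResidueField T') _).mp
        (cohomologyAnnihilatorOfDegree_dualNumber_le (IsLocalRing.ResidueField T') 4 hx)
    have h2 : IsLocalRing.residue T' x = 0 := by
      have : fst (algebraMap T' ((IsLocalRing.ResidueField T')[ε]) x) = IsLocalRing.residue T' x := by
        change fst (algebraMap (IsLocalRing.ResidueField T') ((IsLocalRing.ResidueField T')[ε])
          (IsLocalRing.residue T' x)) = _
        rw [algebraMap_eq_inl']
        simp
      rw [← this, h1]
    exact hT' ((IsLocalRing.residue_eq_zero_iff _).mp h2)
  -- the cover from §3/§4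
  refine hasStepDualCover_of_addCover ((IsLocalRing.ResidueField T')[ε]) ((IsLocalRing.ResidueField T')[ε])
    hasc hsq hdesc
    (fun _ : Fin 1 => ModuleCat.of ((IsLocalRing.ResidueField T')[ε])
      ↥(Ideal.span {(ε : (IsLocalRing.ResidueField T')[ε])})) ?_
    (ModuleCat.of ((IsLocalRing.ResidueField T')[ε])
      ((IsLocalRing.ResidueField T')[ε] × ↥(Ideal.span {(ε : (IsLocalRing.ResidueField T')[ε])})))
    (isRetractOfPower_dualBlock_gen (IsLocalRing.ResidueField T')) ?_
  · intro _
    exact ⟨ModuleCat.of ((IsLocalRing.ResidueField T')[ε]) ↥(Ideal.span {(ε : (IsLocalRing.ResidueField T')[ε])}),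
      Module.Finite.of_injective (Submodule.subtype _) Subtype.val_injective,
      isSyzygy_three_spanEps (IsLocalRing.ResidueField T')⟩
  · intro M L hM hL
    haveI := hM
    haveI : Module.Finite ((IsLocalRing.ResidueField T')[ε]) L := finite_of_isSyzygy 3 hM hL
    exact isRetractOfPower_dualNumber (IsLocalRing.ResidueField T') L

end Summit.ResolutionOfSingularities.ResolutionOfSingularities.Theorems.HomologicalConductor.PersistenceSurfaceMaximalConductorStep

end
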